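import Summits.AtomisticToContinuum.Crystallization.Theorems.FreeSplittingCertificatesRadiusLadderRingStar
import Summits.AtomisticToContinuum.Crystallization.Theorems.FreeSplittingCertificatesRadiusLadderPacking
import Summits.AtomisticToContinuum.Crystallization.Theorems.FreeSplittingCertificatesRadiusLadderRefValue

/-!
# Radius ladder for `ApproxFiniteRangeSplitting`: the tolerance price of blindness is finite at every hard core

Route `FreeSplittingCertificates`, crux r5 `ApproxFiniteRangeSplitting` (stmt-AtomisticToContinuum-12562) / crux r2
`FiniteRangeSplitting` (stmt-AtomisticToContinuum-12559); block-2b unit `b2b-freesplit`, PART A gen 18, companion of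
`…RadiusLadderRingStar`.  Value = a structural theorem about the cruxes' instances — NOT summit progress.

`…RingStar` showed that the `ε`-threshold `δ_½(ε) = approxHalfSumThreshold ε` of the blind rule `Φ ≡ ½` is
positive for EVERY tolerance (`δ_½(ε) ≥ 2/(1 + M²)²` once `M > 24 (ε - B)`).  Here is the converse direction, by
the tree's VOLUME PACKING (`card_near_le`: at most `(2t/δ + 1)³ - 1` other points within distance `< t`;
`sum_inv_pow_six_far_le`: `Σ_{r ≥ 4δ} r⁻⁶ ≤ (1331/512) δ⁻⁶`) and `V_LJ ≥ -1/12`, `V_LJ(r) ≥ -r⁻⁶/6`: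

* `sum_lennardJones_ge_of_sep_pos` — the CRUDE SITE FLOOR: at every site of a `δ`-separated configuration
  (`δ > 0`) `Σ_{j ≠ i} V_LJ(r_ij) ≥ -182/3 - (1331/3072) δ⁻⁶` (728 near points at `≥ -1/12` each, far tail);
* `aHalfSumFeasible_of_le_eps` — hence the blind rule is an `ε`-rung at hard core `δ` (every radius) as soon as
  `ε ≥ 91/3 + (1331/6144) δ⁻⁶` (using `e_∞ ≤ -0.7175 ≤ 0`, `eInf_le_ref`); `approxHalfSumThreshold_le_of_le_eps`:
  `δ_½(ε) ≤ δ` for such `ε`;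
* `tendsto_approxHalfSumThreshold_atTop` — **`δ_½(ε) → 0` as `ε → ∞`**, with the closed form
  `sub_mul_approxHalfSumThreshold_pow_le : (ε - 91/3) · δ_½(ε)⁶ ≤ 1331/6144` (Bernoulli's inequality turns the
  sixth root into algebra);
* `exists_epsPrice` — at every hard core `δ > 0` the set of feasible tolerances is a closed ray: there is a least
  tolerance `ε_½(δ) ∈ [e_∞, 91/3 + (1331/6144) δ⁻⁶]` with `AHalfSumFeasible δ ε ↔ ε_½(δ) ≤ ε` (an infimum over
  configurations, attained because every instance is a closed condition on `ε`); no new definition is introduced —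
  the price is packaged existentially;
* `le_eps_of_aHalfSumFeasible_ringStar`, `epsPrice_unbounded` — the ring stars price small hard cores from
  below: at `δ ≤ 2/(1 + M²)²` every feasible tolerance is `≥ M/24 + B`, so `ε_½(δ) → ∞` as `δ → 0`.

Together with `…RingStar` and `…RadiusFloorApprox` this completes the qualitative phase portrait of the blind rule
in the quarter-plane `(δ, ε)`: feasible iff `δ ≥ δ_½(ε)` iff `ε ≥ ε_½(δ)`; `δ_½(·)` is antitone, `= δ_½ ∈ [47/50, 6/5]`
at `ε = 0`, `↑ δ_½` as `ε ↓ 0`, positive everywhere, and `↓ 0` as `ε → ∞` at rate between `ε^{-4}` (ring stars)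
and `ε^{-1/6}` (packing).  For crux r5 only `ε ↓ 0` matters; the large-`ε` end records that the constants of the
blind rule are a PACKING quantity — tolerance buys hard core, polynomially slowly, never all of it.
-/

namespace Summit.AtomisticToContinuum.Crystallization.Theorems.StrictSplittingRuleBirth

open scoped BigOperators Classical
open Filter Topology
open Literature.MathematicalPhysics.StatisticalMechanics

/-! ## The crude site floor -/

/-- **Crude site floor by packing.**  At every site of a `δ`-separated configuration (`δ > 0`),
`Σ_{j ≠ i} V_LJ(r_ij) ≥ -182/3 - (1331/3072) δ⁻⁶`: the `≤ (2·4δ/δ + 1)³ - 1 = 728` points within `4δ` contribute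
`≥ -1/12` each (`card_near_le`, `neg_one_div_le_lennardJones`), the rest `≥ -(1/6) Σ_{r ≥ 4δ} r⁻⁶ ≥ -(1331/3072) δ⁻⁶`
(`sum_inv_pow_six_far_le`). [folklore] -/
theorem sum_lennardJones_ge_of_sep_pos {δ : ℝ} (hδ : 0 < δ) {N : ℕ} {x : Fin N → EuclideanSpace ℝ (Fin 3)}
    (hx : Sep δ x) (i : Fin N) :
    -(182 / 3) - 1331 / 3072 * δ⁻¹ ^ 6 ≤ ∑ j ∈ Finset.univ.erase i, lennardJones (dist (x i) (x j)) := by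
  set s := Finset.univ.erase i with hs
  have hsplit : ∑ j ∈ s, lennardJones (dist (x i) (x j)) =
      ∑ j ∈ s.filter (fun k => 4 * δ ≤ dist (x i) (x k)), lennardJones (dist (x i) (x j)) +
        ∑ j ∈ s.filter (fun k => ¬ 4 * δ ≤ dist (x i) (x k)), lennardJones (dist (x i) (x j)) :=
    (Finset.sum_filter_add_sum_filter_not s _ _).symm
  -- near part: at most `728` points, each `≥ -1/12`
  have hnear_eq : s.filter (fun k => ¬ 4 * δ ≤ dist (x i) (x k)) = s.filter (fun k => dist (x i) (x k) < 4 * δ) := by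
    simp only [not_le]
  have hcard : (((s.filter fun k => ¬ 4 * δ ≤ dist (x i) (x k)).card : ℕ) : ℝ) ≤ 728 := by
    have h := card_near_le hδ hx i (t := 4 * δ) (by positivity)
    have h8 : 2 * (4 * δ) / δ = (8 : ℝ) := by
      field_simp
      ring
    rw [h8] at h
    rw [hnear_eq]
    norm_num at h ⊢
    exact h
  have hnear : -(182 / 3 : ℝ) ≤ ∑ j ∈ s.filter (fun k => ¬ 4 * δ ≤ dist (x i) (x k)), lennardJones (dist (x i) (x j)) := by
    have h1 : ∑ j ∈ s.filter (fun k => ¬ 4 * δ ≤ dist (x i) (x k)), (-1 / 12 : ℝ) ≤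
        ∑ j ∈ s.filter (fun k => ¬ 4 * δ ≤ dist (x i) (x k)), lennardJones (dist (x i) (x j)) :=
      Finset.sum_le_sum fun j _ => neg_one_div_le_lennardJones _
    rw [Finset.sum_const, nsmul_eq_mul] at h1
    nlinarith [hcard, h1]
  -- far part: the attractive tail
  have hfar : -(1331 / 3072 * δ⁻¹ ^ 6) ≤
      ∑ j ∈ s.filter (fun k => 4 * δ ≤ dist (x i) (x k)), lennardJones (dist (x i) (x j)) := by
    -- `V_LJ(r) ≥ -r⁻⁶/6` (inlined; the tree's copy lives in an unrelated route's module)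
    have h1 : ∑ j ∈ s.filter (fun k => 4 * δ ≤ dist (x i) (x k)), -(1 / 6 * (dist (x i) (x j))⁻¹ ^ 6) ≤
        ∑ j ∈ s.filter (fun k => 4 * δ ≤ dist (x i) (x k)), lennardJones (dist (x i) (x j)) := by
      refine Finset.sum_le_sum fun j _ => ?_
      unfold lennardJones
      have h : (0 : ℝ) ≤ 1 / 12 * ((dist (x i) (x j))⁻¹) ^ 12 := by positivity
      linarith
    have h2 := sum_inv_pow_six_far_le x hδ hx i
    rw [Finset.sum_neg_distrib, ← Finset.mul_sum] at h1
    linarith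
  rw [hsplit]
  linarith

/-- The crude HALF-SUM floor: `½ Σ_{j ≠ i} V_LJ(r_ij) ≥ -91/3 - (1331/6144) δ⁻⁶` at every site of a `δ`-separated
configuration. [folklore] -/
theorem halfSum_ge_of_sep_pos {δ : ℝ} (hδ : 0 < δ) {N : ℕ} {x : Fin N → EuclideanSpace ℝ (Fin 3)}
    (hx : Sep δ x) (i : Fin N) :
    -(91 / 3) - 1331 / 6144 * δ⁻¹ ^ 6 ≤ (∑ j ∈ Finset.univ.erase i, lennardJones (dist (x i) (x j))) / 2 := by
  have h := sum_lennardJones_ge_of_sep_pos hδ hx i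
  linarith

/-! ## Large tolerance buys every hard core -/

/-- **Large tolerance makes the blind rule feasible at every hard core**: for `δ > 0` and
`ε ≥ 91/3 + (1331/6144) δ⁻⁶`, `AHalfSumFeasible δ ε` (the crude floor and `e_∞ ≤ -0.7175 ≤ 0`). [folklore] -/
theorem aHalfSumFeasible_of_le_eps {δ ε : ℝ} (hδ : 0 < δ) (hε : 91 / 3 + 1331 / 6144 * δ⁻¹ ^ 6 ≤ ε) :
    AHalfSumFeasible δ ε := by
  intro N x hx i
  have h := halfSum_ge_of_sep_pos hδ hx i
  have he := eInf_le_ref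
  linarith

/-- Hence `δ_½(ε) ≤ δ` whenever `ε ≥ 91/3 + (1331/6144) δ⁻⁶`. [folklore] -/
theorem approxHalfSumThreshold_le_of_le_eps {δ ε : ℝ} (hδ : 0 < δ) (hε : 91 / 3 + 1331 / 6144 * δ⁻¹ ^ 6 ≤ ε) :
    approxHalfSumThreshold ε ≤ δ :=
  approxHalfSumThreshold_le_of hδ (aHalfSumFeasible_of_le_eps hδ hε)

/-- So the blind rule is an `ε`-rung at `(δ, R)` for EVERY radius once `ε ≥ 91/3 + (1331/6144) δ⁻⁶`. [folklore] -/
theorem arungAt_of_le_eps {δ ε : ℝ} (hδ : 0 < δ) (hε : 91 / 3 + 1331 / 6144 * δ⁻¹ ^ 6 ≤ ε) (R : ℝ) :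
    ARungAt δ ε R :=
  arungAt_of_aHalfSumFeasible (aHalfSumFeasible_of_le_eps hδ hε) R

/-- **`δ_½(ε) → 0` as `ε → ∞`**: tolerance buys hard core. [folklore] -/
theorem tendsto_approxHalfSumThreshold_atTop : Tendsto approxHalfSumThreshold atTop (𝓝 0) := by
  rw [Metric.tendsto_atTop]
  intro γ hγ
  refine ⟨91 / 3 + 1331 / 6144 * (γ / 2)⁻¹ ^ 6, fun ε hε => ?_⟩
  have h1 := approxHalfSumThreshold_le_of_le_eps (half_pos hγ) hε
  have h0 := approxHalfSumThreshold_nonneg ε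
  rw [Real.dist_eq, sub_zero, abs_of_nonneg h0]
  linarith

/-- **Closed form of the decay**: `(ε - 91/3) · δ_½(ε)⁶ ≤ 1331/6144` for every `ε` — i.e. `δ_½(ε) ≤ (1331/(6144(ε - 91/3)))^{1/6}`
for `ε > 91/3`.  (If the product were larger, Bernoulli's inequality `(1 - h)⁶ ≥ 1 - 6h` produces a hard core
`δ < δ_½(ε)` still satisfying the hypothesis of `aHalfSumFeasible_of_le_eps`.) [folklore] -/
theorem sub_mul_approxHalfSumThreshold_pow_le (ε : ℝ) :
    (ε - 91 / 3) * approxHalfSumThreshold ε ^ 6 ≤ 1331 / 6144 := by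
  by_contra hcon
  set t := approxHalfSumThreshold ε with ht
  have ht0 : 0 ≤ t := approxHalfSumThreshold_nonneg ε
  have hP : 1331 / 6144 < (ε - 91 / 3) * t ^ 6 := not_le.mp hcon
  have htpos : 0 < t := by
    rcases ht0.eq_or_lt with h | h
    · rw [← h] at hP
      norm_num at hP
    · exact h
  set P := (ε - 91 / 3) * t ^ 6 with hPdef
  have hPpos : 0 < P := lt_trans (by norm_num) hP
  set q := (1331 / 6144 : ℝ) / P with hq
  have hq1 : q < 1 := (div_lt_one hPpos).mpr hP
  have hq0 : 0 < q := div_pos (by norm_num) hPpos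
  set c := 1 - (1 - q) / 6 with hc
  have hc0 : 0 < c := by rw [hc]; linarith
  have hc1 : c < 1 := by rw [hc]; linarith
  -- Bernoulli: `q = 1 - 6·((1 - q)/6) ≤ (1 - (1 - q)/6)⁶ = c⁶`
  have hbern : q ≤ c ^ 6 := by
    have h := one_add_mul_le_pow (show (-2 : ℝ) ≤ -((1 - q) / 6) by linarith) 6
    have h1 : (1 : ℝ) + (6 : ℕ) * (-((1 - q) / 6)) = q := by push_cast; ring
    have h2 : (1 : ℝ) + -((1 - q) / 6) = c := by rw [hc]; ring
    rw [h1, h2] at h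
    exact h
  have hδpos : 0 < t * c := mul_pos htpos hc0
  have hfeas : AHalfSumFeasible (t * c) ε := by
    apply aHalfSumFeasible_of_le_eps hδpos
    have h1 : P * q = 1331 / 6144 := by
      rw [hq]
      field_simp
    have h2 : P * q ≤ P * c ^ 6 := mul_le_mul_of_nonneg_left hbern hPpos.le
    have h4 : (ε - 91 / 3) * (t * c) ^ 6 = P * c ^ 6 := by rw [hPdef]; ring
    have h5 : 1331 / 6144 ≤ (ε - 91 / 3) * (t * c) ^ 6 := by rw [h4]; linarith
    have h6 : 0 < (t * c) ^ 6 := by positivity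
    have h7 : 1331 / 6144 * (t * c)⁻¹ ^ 6 ≤ ε - 91 / 3 := by
      rw [inv_pow, ← div_eq_mul_inv, div_le_iff₀ h6]
      exact h5
    linarith
  have h8 := approxHalfSumThreshold_le_of hδpos hfeas
  have h9 : t * c < t := mul_lt_of_lt_one_right htpos hc1
  linarith

/-! ## The tolerance price `ε_½(δ)` of blindness at hard core `δ` -/

/-- **The tolerance price of blindness is finite at every hard core.**  For every `δ > 0` there is a least
tolerance `ε₀ = ε_½(δ)` with `AHalfSumFeasible δ ε ↔ ε₀ ≤ ε`, and `e_∞ ≤ ε_½(δ) ≤ 91/3 + (1331/6144) δ⁻⁶`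
(`ε_½(δ) = e_∞ - inf over δ-separated configurations and sites of the half pair-sum`; the infimum over `ε` is
attained because each instance is the closed condition `e_∞ - S/2 ≤ ε`; the lower bound tests the one-point
configuration).  No definition is introduced: the price is packaged existentially. [folklore] -/
theorem exists_epsPrice {δ : ℝ} (hδ : 0 < δ) :
    ∃ ε₀ : ℝ, eInf ≤ ε₀ ∧ ε₀ ≤ 91 / 3 + 1331 / 6144 * δ⁻¹ ^ 6 ∧ ∀ ε : ℝ, AHalfSumFeasible δ ε ↔ ε₀ ≤ ε := by
  set T : Set ℝ := {ε | AHalfSumFeasible δ ε} with hT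
  have hmem : (91 / 3 + 1331 / 6144 * δ⁻¹ ^ 6) ∈ T := aHalfSumFeasible_of_le_eps hδ le_rfl
  have hne : T.Nonempty := ⟨_, hmem⟩
  have hlb : ∀ ε ∈ T, eInf ≤ ε := by
    intro ε hε
    have h := hε 1 (fun _ => 0) (fun a b hab => absurd (Subsingleton.elim a b) hab) 0
    have he : Finset.univ.erase (0 : Fin 1) = ∅ := by decide
    rw [he, Finset.sum_empty, zero_div] at h
    linarith
  have hbdd : BddBelow T := ⟨eInf, hlb⟩
  refine ⟨sInf T, le_csInf hne hlb, csInf_le hbdd hmem, fun ε => ⟨fun h => csInf_le hbdd h, fun h => ?_⟩⟩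
  have hin : AHalfSumFeasible δ (sInf T) := by
    intro N x hx i
    have h1 : eInf - (∑ j ∈ Finset.univ.erase i, lennardJones (dist (x i) (x j))) / 2 ≤ sInf T :=
      le_csInf hne fun ε' hε' => by
        have h2 := hε' N x hx i
        linarith
    linarith
  exact aHalfSumFeasible_mono_eps h hin

/-- **Ring stars price small hard cores from below**: at `δ ≤ 2/(1 + M²)²` every feasible tolerance is
`≥ M/24 + B` (`not_aHalfSumFeasible_ringStar`). [folklore] -/
theorem le_eps_of_aHalfSumFeasible_ringStar {M : ℕ} {δ ε : ℝ} (hδ : δ ≤ 2 / ((1 : ℝ) + (M : ℝ) ^ 2) ^ 2)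
    (h : AHalfSumFeasible δ ε) : (M : ℝ) / 24 + twoConeB ≤ ε := by
  by_contra hlt
  exact not_aHalfSumFeasible_ringStar (not_le.mp hlt) (aHalfSumFeasible_mono_sep hδ h)

/-- Hence the tolerance price is UNBOUNDED as the hard core shrinks: for every `K` there is `δ₀ > 0` such that at
hard cores `δ ≤ δ₀` only tolerances `ε ≥ K` are feasible (`ε_½(δ) → ∞` as `δ → 0`). [folklore] -/
theorem epsPrice_unbounded (K : ℝ) : ∃ δ₀ : ℝ, 0 < δ₀ ∧ ∀ δ ε : ℝ, δ ≤ δ₀ → AHalfSumFeasible δ ε → K ≤ ε := by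
  obtain ⟨M, hM⟩ := exists_nat_gt (24 * (K - twoConeB))
  refine ⟨2 / ((1 : ℝ) + (M : ℝ) ^ 2) ^ 2, by positivity, fun δ ε hδ h => ?_⟩
  have h1 := le_eps_of_aHalfSumFeasible_ringStar hδ h
  linarith

/-- **Two-sided price bracket at a fixed hard core**: for `0 < δ ≤ 2/(1 + M²)²` the least feasible tolerance of
`exists_epsPrice` lies in `[M/24 + B, 91/3 + (1331/6144) δ⁻⁶]`. [folklore] -/
theorem epsPrice_bracket {M : ℕ} {δ : ℝ} (hδ : 0 < δ) (hδM : δ ≤ 2 / ((1 : ℝ) + (M : ℝ) ^ 2) ^ 2) :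
    ∃ ε₀ : ℝ, (M : ℝ) / 24 + twoConeB ≤ ε₀ ∧ ε₀ ≤ 91 / 3 + 1331 / 6144 * δ⁻¹ ^ 6 ∧
      ∀ ε : ℝ, AHalfSumFeasible δ ε ↔ ε₀ ≤ ε := by
  obtain ⟨ε₀, -, hub, hiff⟩ := exists_epsPrice hδ
  exact ⟨ε₀, le_eps_of_aHalfSumFeasible_ringStar hδM ((hiff ε₀).mpr le_rfl), hub, hiff⟩

/-- **Galois form of the phase portrait** (`ε ≥ 0`, `δ > 0`): with `ε₀ = ε_½(δ)` from `exists_epsPrice`,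
`δ_½(ε) ≤ δ ↔ ε_½(δ) ≤ ε` — the blind rule's feasible region `{(δ, ε)}` is an upper set cut out equivalently by the
antitone threshold `δ_½(·)` or by the price `ε_½(·)`. [folklore] -/
theorem approxHalfSumThreshold_le_iff_price_le {δ ε ε₀ : ℝ} (hε : 0 ≤ ε) (hδ : 0 < δ)
    (hiff : ∀ ε' : ℝ, AHalfSumFeasible δ ε' ↔ ε₀ ≤ ε') :
    approxHalfSumThreshold ε ≤ δ ↔ ε₀ ≤ ε := by
  rw [← aHalfSumFeasible_iff_threshold_le hε hδ, hiff]

end Summit.AtomisticToContinuum.Crystallization.Theorems.StrictSplittingRuleBirth
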